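import Mathlib
import HarnessLib

/-!
# Matrix factorisations are exact modulo `f`: for `φ ψ` with `φψ = ψφ = f·1` and `φ` injective,
# `ker φ̄ = range ψ̄` over `T = S ⧸ (f)`

Route `ResolutionOfSingularities/HomologicalConductor`, chain W4.4b (crux `Persistence`
stmt-ResolutionOfSingularities-16484), object U6 of CHAIN v11.1 §V11.11 (c) (res-L1-w44b-plan-1
2026-08-27T09:15Z), res-D-pv-026.  [OURS · L1 w44b; AI-written, weaker than expert review; NOT a statement
of the manuscript under study, and no statement of that manuscript is used.]

The EXACTNESS HALF of every hypersurface certificate of the chain (Eisenbud's matrix factorisations,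
in certificate currency): given a commutative ring `S`, `f ∈ S`, and two commuting `S`-linear maps
(resp. square matrices) `φ`, `ψ` with `φ ∘ ψ = f · id = ψ ∘ φ`, reduction modulo `f` gives a 2-periodic
complex `… → M̄ —ψ̄→ M̄ —φ̄→ M̄ —ψ̄→ …` (`M̄ = M ⧸ f M`, resp. `Tⁿ`, `T = S ⧸ (f)`); it is EXACT at `φ̄`
as soon as `φ` is injective (`ker φ̄ = range ψ̄`: if `φ v = f w = φ ψ w` then `v = ψ w`), and at `ψ̄` as
soon as `ψ` is injective — which follows from the injectivity of `φ` when `f` is a non-zero-divisor on `M`.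

* §1 module form: `ker_mapQ_eq_range_mapQ` (and `…'` for the other spot), `injective_of_comp_eq_smul`
  (`φ ∘ ψ = f • id`, `f` regular on `M` ⇒ `ψ` injective);
* §2 matrix form over `T = S ⧸ (f)`: `ker_mulVecLin_map_eq_range` (+ symmetric),
  `mulVec_injective_of_det_mem_nonZeroDivisors` (the practical injectivity test via the adjugate);
  (the rank-one case `φ = (Y)`, `ψ = (u⁴)` is `…LossFootholdPeriodicB.lean`, p516819).

DEDUP note. `…QuotientHypersurfacePeriodicity.lean` (o9f, `exists_periodic_presentation_quotient`)
goes the OTHER way: it attaches the factorisation `(F₁ ↪ F₀, f•)` to a GIVEN `T`-module of projective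
dimension `≤ 1` over `R` and proves the abstract periodic presentation; here the factorisation is the GIVEN
data and no module, flatness or noetherian hypothesis occurs. Nothing of o9f is restated.

References (mechanism only): D. Eisenbud, *Homological algebra on a complete intersection*, Trans. AMS
260 (1980), §5–6.
-/

noncomputable section

-- single-problem summit: the doubled namespace component `ResolutionOfSingularities` is forced
set_option linter.dupNamespace false

namespace Summit.ResolutionOfSingularities.ResolutionOfSingularities.Theorems.HomologicalConductor.MatrixFactorisationExact

universe u v

/-! ## §1 Module form -/

section Module

variable {S : Type u} [CommRing S] {M : Type v} [AddCommGroup M] [Module S M] (f : S)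

/-- The submodule `f • M` (as the range of the homothety `f • id`). [OURS · L1 w44b] -/
theorem mem_range_smul_id_iff (x : M) :
    x ∈ LinearMap.range (f • (LinearMap.id : M →ₗ[S] M)) ↔ ∃ w : M, f • w = x := by
  simp [LinearMap.mem_range]

/-- Any `S`-linear endomorphism preserves `f • M`. [OURS · L1 w44b] -/
theorem range_smul_id_le_comap (χ : M →ₗ[S] M) :
    LinearMap.range (f • (LinearMap.id : M →ₗ[S] M)) ≤
      (LinearMap.range (f • (LinearMap.id : M →ₗ[S] M))).comap χ := by
  rintro x ⟨w, rfl⟩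
  refine ⟨χ w, ?_⟩
  simp

/-- **Exactness of the reduced matrix factorisation at `φ̄`**: for `S`-linear `φ ψ : M → M` with
`φ ∘ ψ = f • id` and `φ` INJECTIVE, the induced endomorphisms `φ̄ ψ̄` of `M̄ = M ⧸ f M` satisfy
`ker φ̄ = range ψ̄` (if `φ v = f w` then `φ v = φ (ψ w)`, so `v = ψ w`; conversely `φ ψ w = f w ≡ 0`).
[OURS · L1 w44b] -/
theorem ker_mapQ_eq_range_mapQ (φ ψ : M →ₗ[S] M) (hφψ : φ ∘ₗ ψ = f • LinearMap.id)
    (hφ : Function.Injective φ) :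
    LinearMap.ker ((LinearMap.range (f • (LinearMap.id : M →ₗ[S] M))).mapQ _ φ (range_smul_id_le_comap f φ)) =
      LinearMap.range ((LinearMap.range (f • (LinearMap.id : M →ₗ[S] M))).mapQ _ ψ
        (range_smul_id_le_comap f ψ)) := by
  have hφψ' : ∀ w : M, φ (ψ w) = f • w := fun w => by
    have := LinearMap.congr_fun hφψ w
    simpa using this
  ext x
  obtain ⟨v, rfl⟩ := Submodule.Quotient.mk_surjective _ x
  constructor
  · intro hx
    rw [LinearMap.mem_ker, Submodule.mapQ_apply, Submodule.Quotient.mk_eq_zero, mem_range_smul_id_iff] at hx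
    obtain ⟨w, hw⟩ := hx
    -- `φ v = f • w = φ (ψ w)`, hence `v = ψ w`
    have hv : v = ψ w := hφ (by rw [← hw, hφψ'])
    exact ⟨Submodule.Quotient.mk w, by rw [Submodule.mapQ_apply, hv]⟩
  · rintro ⟨y, hy⟩
    obtain ⟨w, rfl⟩ := Submodule.Quotient.mk_surjective _ y
    rw [Submodule.mapQ_apply] at hy
    rw [← hy, LinearMap.mem_ker, Submodule.mapQ_apply, Submodule.Quotient.mk_eq_zero, mem_range_smul_id_iff]
    exact ⟨w, (hφψ' w).symm⟩

/-- **Exactness at `ψ̄`** (the symmetric spot): with `ψ ∘ φ = f • id` and `ψ` injective,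
`ker ψ̄ = range φ̄`. [OURS · L1 w44b] -/
theorem ker_mapQ_eq_range_mapQ' (φ ψ : M →ₗ[S] M) (hψφ : ψ ∘ₗ φ = f • LinearMap.id)
    (hψ : Function.Injective ψ) :
    LinearMap.ker ((LinearMap.range (f • (LinearMap.id : M →ₗ[S] M))).mapQ _ ψ (range_smul_id_le_comap f ψ)) =
      LinearMap.range ((LinearMap.range (f • (LinearMap.id : M →ₗ[S] M))).mapQ _ φ
        (range_smul_id_le_comap f φ)) :=
  ker_mapQ_eq_range_mapQ f ψ φ hψφ hψ

/-- **One injectivity gives the other**: if `φ ∘ ψ = f • id` and `f` is a non-zero-divisor ON `M`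
(`f • m = 0 → m = 0`, e.g. `M = Sⁿ` with `f ∈ S⁰`), then `ψ` is injective. [OURS · L1 w44b] -/
theorem injective_of_comp_eq_smul (φ ψ : M →ₗ[S] M) (hφψ : φ ∘ₗ ψ = f • LinearMap.id)
    (hf : ∀ m : M, f • m = 0 → m = 0) : Function.Injective ψ := by
  intro a b hab
  have h1 : φ (ψ a) = φ (ψ b) := by rw [hab]
  have h2 : f • a = f • b := by
    have ha := LinearMap.congr_fun hφψ a
    have hb := LinearMap.congr_fun hφψ b
    simp only [LinearMap.coe_comp, Function.comp_apply, LinearMap.smul_apply, LinearMap.id_coe, id_eq] at ha hb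
    rw [← ha, ← hb, h1]
  have h3 : f • (a - b) = 0 := by rw [smul_sub, h2, sub_self]
  exact sub_eq_zero.mp (hf _ h3)

/-- Hence, for `φ ∘ ψ = f • id = ψ ∘ φ` with `φ` injective and `f` regular on `M`, BOTH spots of the reduced
2-periodic complex are exact: `ker φ̄ = range ψ̄` and `ker ψ̄ = range φ̄`. [OURS · L1 w44b] -/
theorem ker_eq_range_and_ker_eq_range (φ ψ : M →ₗ[S] M) (hφψ : φ ∘ₗ ψ = f • LinearMap.id)
    (hψφ : ψ ∘ₗ φ = f • LinearMap.id) (hφ : Function.Injective φ) (hf : ∀ m : M, f • m = 0 → m = 0) :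
    LinearMap.ker ((LinearMap.range (f • (LinearMap.id : M →ₗ[S] M))).mapQ _ φ (range_smul_id_le_comap f φ)) =
      LinearMap.range ((LinearMap.range (f • (LinearMap.id : M →ₗ[S] M))).mapQ _ ψ
        (range_smul_id_le_comap f ψ)) ∧
    LinearMap.ker ((LinearMap.range (f • (LinearMap.id : M →ₗ[S] M))).mapQ _ ψ (range_smul_id_le_comap f ψ)) =
      LinearMap.range ((LinearMap.range (f • (LinearMap.id : M →ₗ[S] M))).mapQ _ φ
        (range_smul_id_le_comap f φ)) :=
  ⟨ker_mapQ_eq_range_mapQ f φ ψ hφψ hφ,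
    ker_mapQ_eq_range_mapQ' f φ ψ hψφ (injective_of_comp_eq_smul f φ ψ hφψ hf)⟩

end Module

/-! ## §2 Matrix form over `T = S ⧸ (f)` -/

section Matrix

variable {S : Type u} [CommRing S] {ι : Type} [Fintype ι] [DecidableEq ι] (f : S)

open Matrix

omit [DecidableEq ι] in
/-- Reduction modulo `f` of vectors commutes with `mulVec` (Mathlib `RingHom.map_mulVec`, pointwise form).
[OURS · L1 w44b] -/
theorem map_mulVec_comp (φ : Matrix ι ι S) (v : ι → S) :
    (φ.map (Ideal.Quotient.mk (Ideal.span {f}))) *ᵥ ((Ideal.Quotient.mk (Ideal.span {f})) ∘ v) =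
      (Ideal.Quotient.mk (Ideal.span {f})) ∘ (φ *ᵥ v) := by
  funext i
  exact (RingHom.map_mulVec (Ideal.Quotient.mk (Ideal.span {f})) φ v i).symm

/-- The reduction of `f • 1` modulo `f` kills every vector. [OURS · L1 w44b] -/
theorem map_smul_one_mulVec (u : ι → S ⧸ Ideal.span {f}) :
    ((f • (1 : Matrix ι ι S)).map (Ideal.Quotient.mk (Ideal.span {f}))) *ᵥ u = 0 := by
  have h : (f • (1 : Matrix ι ι S)).map (Ideal.Quotient.mk (Ideal.span {f})) = 0 := by
    ext i j
    simp only [Matrix.map_apply, Matrix.smul_apply, smul_eq_mul, map_mul, Matrix.zero_apply]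
    rw [Ideal.Quotient.eq_zero_iff_mem.mpr (Ideal.mem_span_singleton_self f), zero_mul]
  rw [h, Matrix.zero_mulVec]

/-- **Exactness of a matrix factorisation modulo `f`, at `φ̄`**: for square matrices `φ ψ` over `S` with
`φ ψ = f·1` and `φ` injective on `Sⁿ`, the reduced matrices over `T = S ⧸ (f)` satisfy
`ker φ̄ = range ψ̄` (as `T`-linear maps on `Tⁿ`). Proof: lift `v ∈ ker φ̄` to `vl ∈ Sⁿ`; `φ vl ∈ f Sⁿ`, say
`φ vl = f w = φ ψ w`, so `vl = ψ w` and `v = ψ̄ w̄`. [OURS · L1 w44b] -/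
theorem ker_mulVecLin_map_eq_range (φ ψ : Matrix ι ι S) (hφψ : φ * ψ = f • (1 : Matrix ι ι S))
    (hφ : Function.Injective φ.mulVec) :
    LinearMap.ker (φ.map (Ideal.Quotient.mk (Ideal.span {f}))).mulVecLin =
      LinearMap.range (ψ.map (Ideal.Quotient.mk (Ideal.span {f}))).mulVecLin := by
  set mk := Ideal.Quotient.mk (Ideal.span {f}) with hmk
  ext v
  constructor
  · intro hv
    rw [LinearMap.mem_ker, Matrix.mulVecLin_apply] at hv
    -- lift `v`
    have hlift : ∃ vl : ι → S, mk ∘ vl = v := ⟨fun i => (Ideal.Quotient.mk_surjective (v i)).choose,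
      funext fun i => (Ideal.Quotient.mk_surjective (v i)).choose_spec⟩
    obtain ⟨vl, rfl⟩ := hlift
    rw [map_mulVec_comp] at hv
    -- every component of `φ vl` is a multiple of `f`
    have hw : ∃ w : ι → S, φ *ᵥ vl = f • w := by
      have hc : ∀ i, ∃ c : S, c * f = (φ *ᵥ vl) i := fun i => by
        have hi := congrFun hv i
        simp only [Function.comp_apply, Pi.zero_apply] at hi
        exact Ideal.mem_span_singleton'.mp (Ideal.Quotient.eq_zero_iff_mem.mp hi)
      choose c hc using hc
      exact ⟨c, funext fun i => by rw [Pi.smul_apply, smul_eq_mul, mul_comm, hc i]⟩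
    obtain ⟨w, hw⟩ := hw
    have hvl : vl = ψ *ᵥ w := by
      apply hφ
      rw [hw, Matrix.mulVec_mulVec, hφψ, Matrix.smul_mulVec, Matrix.one_mulVec]
    refine ⟨mk ∘ w, ?_⟩
    rw [Matrix.mulVecLin_apply, map_mulVec_comp, ← hvl]
  · rintro ⟨u, rfl⟩
    rw [LinearMap.mem_ker, Matrix.mulVecLin_apply, Matrix.mulVecLin_apply, Matrix.mulVec_mulVec, ← Matrix.map_mul,
      hφψ, map_smul_one_mulVec]

/-- **Exactness at the other spot**: with `ψ φ = f·1` and `ψ` injective, `ker ψ̄ = range φ̄`. [OURS · L1 w44b] -/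
theorem ker_mulVecLin_map_eq_range' (φ ψ : Matrix ι ι S) (hψφ : ψ * φ = f • (1 : Matrix ι ι S))
    (hψ : Function.Injective ψ.mulVec) :
    LinearMap.ker (ψ.map (Ideal.Quotient.mk (Ideal.span {f}))).mulVecLin =
      LinearMap.range (φ.map (Ideal.Quotient.mk (Ideal.span {f}))).mulVecLin :=
  ker_mulVecLin_map_eq_range f ψ φ hψφ hψ

/-- **Injectivity test via the adjugate**: if `det φ` is a non-zero-divisor of `S`, then `φ` is injective on `Sⁿ`
(`adj φ · φ = det φ · 1`). In the consumers `det φ` is a unit times a power of `f`, `f ∈ S⁰`. [OURS · L1 w44b] -/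
theorem mulVec_injective_of_det_mem_nonZeroDivisors (φ : Matrix ι ι S) (hdet : φ.det ∈ nonZeroDivisors S) :
    Function.Injective φ.mulVec := by
  intro a b hab
  have h1 : φ.adjugate *ᵥ (φ *ᵥ a) = φ.adjugate *ᵥ (φ *ᵥ b) := by rw [hab]
  rw [Matrix.mulVec_mulVec, Matrix.mulVec_mulVec, Matrix.adjugate_mul, Matrix.smul_mulVec,
    Matrix.smul_mulVec, Matrix.one_mulVec, Matrix.one_mulVec] at h1
  funext i
  have hi : φ.det * a i = φ.det * b i := by
    have := congrFun h1 i
    simpa only [Pi.smul_apply, smul_eq_mul] using this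
  have h2 : φ.det * (a i - b i) = 0 := by rw [mul_sub, hi, sub_self]
  exact sub_eq_zero.mp ((mem_nonZeroDivisors_iff_right.mp hdet) _ (by rwa [mul_comm] at h2))

/-- `ψ` is injective as soon as `φ ψ = f·1`, `f ∈ S⁰` (and then no separate test for `ψ` is needed).
[OURS · L1 w44b] -/
theorem mulVec_injective_of_mul_eq_smul_one (φ ψ : Matrix ι ι S) (hφψ : φ * ψ = f • (1 : Matrix ι ι S))
    (hf : f ∈ nonZeroDivisors S) : Function.Injective ψ.mulVec := by
  intro a b hab
  have h1 : φ *ᵥ (ψ *ᵥ a) = φ *ᵥ (ψ *ᵥ b) := by rw [hab]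
  rw [Matrix.mulVec_mulVec, Matrix.mulVec_mulVec, hφψ, Matrix.smul_mulVec, Matrix.smul_mulVec,
    Matrix.one_mulVec, Matrix.one_mulVec] at h1
  funext i
  have hi : f * a i = f * b i := by
    have := congrFun h1 i
    simpa only [Pi.smul_apply, smul_eq_mul] using this
  have h2 : f * (a i - b i) = 0 := by rw [mul_sub, hi, sub_self]
  exact sub_eq_zero.mp ((mem_nonZeroDivisors_iff_right.mp hf) _ (by rwa [mul_comm] at h2))

/-- **Both spots at once** (the form the certificates consume): `φ ψ = f·1 = ψ φ`, `f ∈ S⁰`, `det φ ∈ S⁰` ⇒ over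
`T = S ⧸ (f)`, `ker φ̄ = range ψ̄` and `ker ψ̄ = range φ̄`. [OURS · L1 w44b] -/
theorem matrixFactorisation_exact (φ ψ : Matrix ι ι S) (hφψ : φ * ψ = f • (1 : Matrix ι ι S))
    (hψφ : ψ * φ = f • (1 : Matrix ι ι S)) (hf : f ∈ nonZeroDivisors S) (hdet : φ.det ∈ nonZeroDivisors S) :
    LinearMap.ker (φ.map (Ideal.Quotient.mk (Ideal.span {f}))).mulVecLin =
        LinearMap.range (ψ.map (Ideal.Quotient.mk (Ideal.span {f}))).mulVecLin ∧
      LinearMap.ker (ψ.map (Ideal.Quotient.mk (Ideal.span {f}))).mulVecLin =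
        LinearMap.range (φ.map (Ideal.Quotient.mk (Ideal.span {f}))).mulVecLin :=
  ⟨ker_mulVecLin_map_eq_range f φ ψ hφψ (mulVec_injective_of_det_mem_nonZeroDivisors φ hdet),
    ker_mulVecLin_map_eq_range' f φ ψ hψφ (mulVec_injective_of_mul_eq_smul_one f φ ψ hφψ hf)⟩

end Matrix

end Summit.ResolutionOfSingularities.ResolutionOfSingularities.Theorems.HomologicalConductor.MatrixFactorisationExact

end
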